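import Summits.SmoothPoincare4.SmoothPoincare4.Theses.WeakReductionDescent
import Literature.Topology.FourManifolds.TrisectionEulerProofs
import Literature.Topology.FourManifolds.HomotopyS4CompactProofs
import Literature.Topology.FourManifolds.HomotopyS4OrientableProofs

/-!
# Crux `WeakReductionDescent.MinimalWeaklyReducibleFromFour` (stmt-SmoothPoincare4-18019), line `Sketch`
# (spine A = KCap), stub `stub_pigeonhole`

The pigeonhole step of the KCap composition: a GK-trisection `T` of type `(g; k 0, k 1, k 2)` of a
smooth homotopy `4`-sphere `M` (bare binders + `e : M ≃ₕ S⁴`) with `g ≥ 4` has a label `p : Fin 3`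
with `2 ≤ k p`.

Proof: `M` is compact (`compactSpace_of_homotopyEquiv_sphere_four_holds`, PROVED) and orientable
(`isOrientable_of_homotopyEquiv_sphere_four_holds`, PROVED), so the proved Euler-characteristic
theorem `gkTrisection_genus_eq_sum_of_homotopyEquiv_sphere_holds` (Gay–Kirby 2016 Remark 2 /
Meier–Schirmer–Zupan 2016 Remark 3.12: `χ = 2` forces `g = k 0 + k 1 + k 2`) applies; if every
`k p ≤ 1` then `g ≤ 3`, contradicting `4 ≤ g`.  Pure arithmetic over proved tree theorems; no
named-fact hypothesis is taken.

## References

* D. Gay, R. Kirby, *Trisecting 4-manifolds*, Geom. Topol. 20 (2016), Remark 2. [GayKirby2016]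
* J. Meier, T. Schirmer, A. Zupan, *Classification of trisections and the Generalized Property R
  Conjecture*, Proc. AMS 144 (2016), Remark 3.12. [MeierSchirmerZupan2016]
-/

noncomputable section

open scoped Manifold ContDiff Topology ContinuousMap
open Set
open Literature.Topology.FourManifolds
open Summit.SmoothPoincare4.SmoothPoincare4.Theses.WeakReductionDescent

namespace Summit.SmoothPoincare4.SmoothPoincare4.Theorems.MinimalWeaklyReducibleFromFour.KCap

-- the registered namespace `Summit.SmoothPoincare4.SmoothPoincare4.Theorems…` repeats a component
set_option linter.dupNamespace false

/-- **Pigeonhole (stub `stub_pigeonhole` of crux stmt-SmoothPoincare4-18019, line `Sketch`).**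
A GK-trisection of type `(g; k 0, k 1, k 2)` and genus `g ≥ 4` of a smooth homotopy `4`-sphere has
a label `p` with `2 ≤ k p`: by the PROVED Euler-characteristic theorem
`gkTrisection_genus_eq_sum_of_homotopyEquiv_sphere_holds` (compactness and orientability of
`M ≃ₕ S⁴` being proved tree theorems) `g = k 0 + k 1 + k 2`, and three numbers `≤ 1` sum to
`≤ 3 < 4 ≤ g`. [cite: GayKirby2016, Remark 2] [cite: MeierSchirmerZupan2016, Remark 3.12] -/
theorem stub_pigeonhole :
    ∀ (M : Type) [TopologicalSpace M] [T2Space M] [SecondCountableTopology M] [ChartedSpace (EuclideanSpace ℝ (Fin 4)) M] [IsManifold (𝓡 4) ((⊤ : ℕ∞) : WithTop ℕ∞) M], (M ≃ₕ (Metric.sphere (0 : EuclideanSpace ℝ (Fin 5)) 1)) → ∀ (g : ℕ) (k : Fin 3 → ℕ) (T : Fin 3 → Set M), Literature.Topology.FourManifolds.IsGKTrisection M g k T → 4 ≤ g → ∃ p : Fin 3, 2 ≤ k p := by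
  intro M _ _ _ _ _ e g k T hT hg
  -- `M ≃ₕ S⁴` is compact and orientable (proved tree theorems)
  haveI : CompactSpace M := compactSpace_of_homotopyEquiv_sphere_four_holds M e
  obtain ⟨o⟩ := isOrientable_of_homotopyEquiv_sphere_four_holds M e
  -- `χ = 2` forces `g = k 0 + k 1 + k 2` (proved Euler-characteristic theorem)
  have hsum : g = k 0 + k 1 + k 2 :=
    gkTrisection_genus_eq_sum_of_homotopyEquiv_sphere_holds M o g k T hT e
  -- pigeonhole: if every `k p ≤ 1` then `g ≤ 3`
  by_contra h
  push Not at h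
  have h0 := h 0
  have h1 := h 1
  have h2 := h 2
  omega

end Summit.SmoothPoincare4.SmoothPoincare4.Theorems.MinimalWeaklyReducibleFromFour.KCap

end
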